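import Summits.Ventures.PercRepro.S1CoreCapLemmas

/-!
# PercRepro — the fat entries of the 4-circuit cap table (p1, gen 21; `proofs/P1-S4-PERPOINT.md` §9.3)

A line of `N = M ∕ e` with a PARALLEL CLASS `{p, q}` is a plane `P ∋ e` of `M` containing the M-line `{e, p, q}`;
no 4-circuit through `e` contains both `p` and `q`. Hence
* `ncard_triples_through_pair` — the 3-subsets of a finite `Q` through two given points number `|Q| − 2`;
* **`ncard_fourCircuitsThrough_in_five_plane_fat_le_two`** — a 5-point plane `P ∋ e` with an M-line `{e, p, q}`
  carries ≤ 2 four-circuits through `e` (the `(3 classes, 1 fat)` entry);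
* **`ncard_fourCircuitsThrough_in_six_plane_two_fat_le_four`** — a 6-point plane `P ∋ e` with two M-lines
  `{e, p, q}`, `{e, r, s}` carries ≤ 4 (the `(3 classes, 2 fat)` entry).
Axioms: standard.
-/

open scoped Matroid

namespace PercRepro

namespace S1

open Set

variable {α : Type}

/-- The 3-subsets of a finite set `Q` containing two given distinct points `u, v ∈ Q` number `|Q| − 2`. -/
theorem ncard_triples_through_pair (Q : Set α) (hQ : Q.Finite) {u v : α} (hu : u ∈ Q) (hv : v ∈ Q) (huv : u ≠ v) :
    {S : Set α | S ⊆ Q ∧ S.ncard = 3 ∧ u ∈ S ∧ v ∈ S}.ncard = Q.ncard - 2 := by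
  classical
  have hsub : ({u, v} : Set α) ⊆ Q := by
    intro t ht; simp only [mem_insert_iff, mem_singleton_iff] at ht; rcases ht with rfl | rfl; exact hu; exact hv
  have hAeq : {S : Set α | S ⊆ Q ∧ S.ncard = 3 ∧ u ∈ S ∧ v ∈ S} = (fun t => ({u, v, t} : Set α)) '' (Q \ {u, v}) := by
    ext S
    simp only [mem_setOf_eq, mem_image, mem_sdiff, mem_insert_iff, mem_singleton_iff, not_or]
    constructor
    · rintro ⟨hSQ, hS3, huS, hvS⟩
      have hsub' : ({u, v} : Set α) ⊆ S := by
        intro t ht; simp only [mem_insert_iff, mem_singleton_iff] at ht; rcases ht with rfl | rfl; exact huS; exact hvS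
      have hrest : (S \ {u, v}).ncard = 1 := by
        have := ncard_sdiff_add_ncard_of_subset hsub' (hQ.subset hSQ)
        rw [ncard_pair huv] at this; omega
      obtain ⟨t, ht⟩ := ncard_eq_one.1 hrest
      have htS : t ∈ S \ {u, v} := by rw [ht]; simp
      refine ⟨t, ⟨hSQ htS.1, ?_, ?_⟩, ?_⟩
      · intro h; exact htS.2 (by rw [h]; simp)
      · intro h; exact htS.2 (by rw [h]; simp)
      · apply Subset.antisymm
        · intro w hw
          simp only [mem_insert_iff, mem_singleton_iff] at hw
          rcases hw with rfl | rfl | rfl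
          · exact huS
          · exact hvS
          · exact htS.1
        · intro w hw
          by_cases hwu : w = u
          · simp [hwu]
          by_cases hwv : w = v
          · simp [hwv]
          have : w ∈ S \ {u, v} := ⟨hw, by simp [hwu, hwv]⟩
          rw [ht] at this
          simp only [mem_singleton_iff] at this
          simp [this]
    · rintro ⟨t, ⟨htQ, htu, htv⟩, rfl⟩
      refine ⟨?_, ?_, by simp, by simp⟩
      · intro w hw
        simp only [mem_insert_iff, mem_singleton_iff] at hw
        rcases hw with rfl | rfl | rfl
        · exact hu
        · exact hv
        · exact htQ
      · exact ncard_eq_three.2 ⟨u, v, t, huv, fun h => htu h.symm, fun h => htv h.symm, rfl⟩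
  rw [hAeq, InjOn.ncard_image]
  · have := ncard_sdiff_add_ncard_of_subset hsub hQ
    rw [ncard_pair huv] at this; omega
  · intro t ht t' ht' htt'
    simp only at htt'
    have : t ∈ ({u, v, t'} : Set α) := htt' ▸ (by simp)
    simp only [mem_insert_iff, mem_singleton_iff] at this
    rcases this with h | h | h
    · exact absurd h (fun h => ht.2 (by rw [h]; simp))
    · exact absurd h (fun h => ht.2 (by rw [h]; simp))
    · exact h

/-- The 4-circuits through `e` inside `P` inject into the 3-subsets of `P ∖ {e}` avoiding every pair `{u, v}` with
`M.eRk {e, u, v} ≤ 2` — the general kill count: with `Q := P ∖ {e}` and `K` the 3-subsets of `Q` through such a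
pair, `#𝒞 ≤ #(𝒯 ∖ K)`. -/
theorem ncard_fourCircuitsThrough_in_plane_le_of_kill (M : Matroid α) [M.Finite] {P : Set α}
    (hP : P ⊆ M.E) {e : α} {K : Set (Set α)}
    (hK : K ⊆ {S : Set α | S ⊆ P \ {e} ∧ S.ncard = 3})
    (hkill : ∀ C, M.IsCircuit C → C.ncard = 4 → e ∈ C → C ⊆ P → C \ {e} ∉ K) :
    {C : Set α | M.IsCircuit C ∧ C.ncard = 4 ∧ e ∈ C ∧ C ⊆ P}.ncard ≤
      ((P \ {e}).ncard.choose 3) - K.ncard := by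
  classical
  have hPfin : P.Finite := M.ground_finite.subset hP
  set Q := P \ {e} with hQ
  have hQfin : Q.Finite := hPfin.subset sdiff_subset
  set 𝒯 := {S : Set α | S ⊆ Q ∧ S.ncard = 3} with h𝒯
  have h𝒯fin : 𝒯.Finite := hQfin.finite_subsets.subset (fun S hS => hS.1)
  have h𝒯c : 𝒯.ncard = Q.ncard.choose 3 := by rw [h𝒯, ncard_subsets_eq_choose Q hQfin 3]
  have hmap : ∀ C ∈ {C : Set α | M.IsCircuit C ∧ C.ncard = 4 ∧ e ∈ C ∧ C ⊆ P}, C \ {e} ∈ 𝒯 \ K := by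
    intro C hC
    obtain ⟨hCc, hC4, heC, hCP⟩ := hC
    refine ⟨⟨fun t ht => ⟨hCP ht.1, ht.2⟩, ?_⟩, hkill C hCc hC4 heC hCP⟩
    have := ncard_sdiff_singleton_add_one heC (M.ground_finite.subset hCc.subset_ground)
    omega
  have hinj : InjOn (fun C : Set α => C \ {e}) {C : Set α | M.IsCircuit C ∧ C.ncard = 4 ∧ e ∈ C ∧ C ⊆ P} := by
    intro C hC C' hC' hCC'
    simp only at hCC'
    have h1 : C = insert e (C \ {e}) := (insert_sdiff_singleton.trans (insert_eq_of_mem hC.2.2.1)).symm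
    have h2 : C' = insert e (C' \ {e}) := (insert_sdiff_singleton.trans (insert_eq_of_mem hC'.2.2.1)).symm
    rw [h1, h2, hCC']
  have := ncard_le_ncard_of_injOn (fun C : Set α => C \ {e}) hmap hinj (h𝒯fin.subset sdiff_subset)
  rw [ncard_sdiff hK (h𝒯fin.subset hK), h𝒯c] at this
  exact this

/-- The kill set of an M-line `{e, u, v}` through `e`: no 4-circuit through `e` contains both `u` and `v`. -/
theorem not_mem_kill_of_line (M : Matroid α) {P : Set α} {e u v : α} (hruv : M.eRk {e, u, v} ≤ 2)
    (hue : u ≠ e) (hve : v ≠ e) (huv : u ≠ v) :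
    ∀ C, M.IsCircuit C → C.ncard = 4 → e ∈ C → C ⊆ P →
      C \ {e} ∉ {S : Set α | S ⊆ P \ {e} ∧ S.ncard = 3 ∧ u ∈ S ∧ v ∈ S} := by
  intro C hC hC4 heC _ hmem
  refine not_fourCircuit_of_triple_subset M hC hC4 (T := {e, u, v}) ?_ ?_ hruv
  · intro t ht; simp only [mem_insert_iff, mem_singleton_iff] at ht
    rcases ht with rfl | rfl | rfl
    · exact heC
    · exact hmem.2.2.1.1
    · exact hmem.2.2.2.1
  · exact ncard_eq_three.2 ⟨e, u, v, hue.symm, hve.symm, huv, rfl⟩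

/-- **The `(3 classes, 1 fat)` entry**: a 5-point plane `P ∋ e` with an M-line `{e, p, q}` through `e` carries at most
2 four-circuits through `e`. -/
theorem ncard_fourCircuitsThrough_in_five_plane_fat_le_two (M : Matroid α) [M.Finite] {P : Set α}
    (hP : P ⊆ M.E) (h5 : P.ncard = 5) {e p q : α} (he : e ∈ P) (hp : p ∈ P) (hq : q ∈ P)
    (hpe : p ≠ e) (hqe : q ≠ e) (hpq : p ≠ q) (hr : M.eRk {e, p, q} ≤ 2) :
    {C : Set α | M.IsCircuit C ∧ C.ncard = 4 ∧ e ∈ C ∧ C ⊆ P}.ncard ≤ 2 := by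
  have hPfin : P.Finite := M.ground_finite.subset hP
  have hQ4 : (P \ {e}).ncard = 4 := by
    have := ncard_sdiff_singleton_add_one he hPfin; omega
  set K := {S : Set α | S ⊆ P \ {e} ∧ S.ncard = 3 ∧ p ∈ S ∧ q ∈ S} with hK
  have hKsub : K ⊆ {S : Set α | S ⊆ P \ {e} ∧ S.ncard = 3} := fun S hS => ⟨hS.1, hS.2.1⟩
  have hK2 : K.ncard = 2 := by
    rw [hK, ncard_triples_through_pair (P \ {e}) (hPfin.subset sdiff_subset) ⟨hp, hpe⟩ ⟨hq, hqe⟩ hpq, hQ4]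
  have := ncard_fourCircuitsThrough_in_plane_le_of_kill M hP hKsub
    (not_mem_kill_of_line M hr hpe hqe hpq)
  rw [hQ4, hK2] at this
  exact this.trans (by decide)

/-- **The `(3 classes, 2 fat)` entry**: a 6-point plane `P ∋ e` with two M-lines `{e, p, q}`, `{e, r, s}` through `e`
carries at most 4 four-circuits through `e`. -/
theorem ncard_fourCircuitsThrough_in_six_plane_two_fat_le_four (M : Matroid α) [M.Finite] {P : Set α}
    (hP : P ⊆ M.E) (h6 : P.ncard = 6) {e p q r s : α} (he : e ∈ P) (hp : p ∈ P) (hq : q ∈ P) (hr' : r ∈ P)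
    (hs : s ∈ P) (hpe : p ≠ e) (hqe : q ≠ e) (hre : r ≠ e) (hse : s ≠ e) (hpq : p ≠ q) (hrs : r ≠ s)
    (hpr : p ≠ r) (hps : p ≠ s) (hqr : q ≠ r) (hqs : q ≠ s)
    (hr1 : M.eRk {e, p, q} ≤ 2) (hr2 : M.eRk {e, r, s} ≤ 2) :
    {C : Set α | M.IsCircuit C ∧ C.ncard = 4 ∧ e ∈ C ∧ C ⊆ P}.ncard ≤ 4 := by
  have hPfin : P.Finite := M.ground_finite.subset hP
  have hQ5 : (P \ {e}).ncard = 5 := by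
    have := ncard_sdiff_singleton_add_one he hPfin; omega
  have hQfin : (P \ {e}).Finite := hPfin.subset sdiff_subset
  set K1 := {S : Set α | S ⊆ P \ {e} ∧ S.ncard = 3 ∧ p ∈ S ∧ q ∈ S} with hK1
  set K2 := {S : Set α | S ⊆ P \ {e} ∧ S.ncard = 3 ∧ r ∈ S ∧ s ∈ S} with hK2
  have hK1c : K1.ncard = 3 := by
    rw [hK1, ncard_triples_through_pair (P \ {e}) hQfin ⟨hp, hpe⟩ ⟨hq, hqe⟩ hpq, hQ5]
  have hK2c : K2.ncard = 3 := by
    rw [hK2, ncard_triples_through_pair (P \ {e}) hQfin ⟨hr', hre⟩ ⟨hs, hse⟩ hrs, hQ5]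
  have hdisj : Disjoint K1 K2 := by
    rw [disjoint_left]
    intro S h1 h2
    have hsub : ({p, q, r, s} : Set α) ⊆ S := by
      intro t ht; simp only [mem_insert_iff, mem_singleton_iff] at ht
      rcases ht with rfl | rfl | rfl | rfl
      · exact h1.2.2.1
      · exact h1.2.2.2
      · exact h2.2.2.1
      · exact h2.2.2.2
    have h4 : ({p, q, r, s} : Set α).ncard = 4 := by
      rw [ncard_insert_of_notMem (by simp [hpq, hpr, hps]) (toFinite _),
        ncard_eq_three.2 ⟨q, r, s, hqr, hqs, hrs, rfl⟩]
    have := ncard_le_ncard hsub (hQfin.subset h1.1)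
    have hS3 := h1.2.1
    omega
  have hKsub : K1 ∪ K2 ⊆ {S : Set α | S ⊆ P \ {e} ∧ S.ncard = 3} := by
    intro S hS; rcases hS with h | h; exact ⟨h.1, h.2.1⟩; exact ⟨h.1, h.2.1⟩
  have hKc : (K1 ∪ K2).ncard = 6 := by
    rw [ncard_union_eq hdisj (hQfin.finite_subsets.subset (fun S hS => hS.1)) (hQfin.finite_subsets.subset (fun S hS => hS.1)),
      hK1c, hK2c]
  have := ncard_fourCircuitsThrough_in_plane_le_of_kill M hP hKsub (by
    intro C hC hC4 heC hCP hmem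
    rcases hmem with h | h
    · exact not_mem_kill_of_line M hr1 hpe hqe hpq C hC hC4 heC hCP h
    · exact not_mem_kill_of_line M hr2 hre hse hrs C hC hC4 heC hCP h)
  rw [hQ5, hKc] at this
  exact this.trans (by decide)

end S1

end PercRepro
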